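import Summits.HubbardSuperconductivity.HubbardSuperconductivity.Theorems.NodalWardXYNodalReductionTrialStateBound
import Summits.HubbardSuperconductivity.HubbardSuperconductivity.Theorems.NodalWardXYNodalReductionDoubleCommutatorForm
import Summits.HubbardSuperconductivity.HubbardSuperconductivity.Theorems.NodalWardXYNodalReductionOrderSqLower
import Summits.HubbardSuperconductivity.HubbardSuperconductivity.Theorems.NodalWardXYNodalReductionSelectionRules
import Summits.HubbardSuperconductivity.HubbardSuperconductivity.Theorems.NodalWardXYNodalReductionGoodGroundVector
import Summits.HubbardSuperconductivity.HubbardSuperconductivity.Theorems.NodalWardXYNodalReductionKTBridge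

/-!
# The Koma–Tasaki / Kaplan–Horsch–von der Linden bridge for the grand-canonical Hubbard torus — PROVED

Crux `NodalWardXY.NodalReduction` (stmt-HubbardSuperconductivity-1268), line `Sketch`: the registered stubs
(A) `stub_trialStateBound`, (B) `stub_doubleCommutatorForm`, (C) `stub_orderSqLower`, (D) `stub_selectionRules`,
(E) `stub_goodGroundVector` and the assembly (F) `stub_ktBridge_of` have all landed, so the named statement
`KTBridge` of `Theorems/NodalWardXYNodalReductionDefs.lean` is now an unconditional theorem:

  for all `U μ a`, `0 < a`: if eventually in `L`
  `a (L+1)⁴ ≤ Re ω₀^{L+1}(Δ_dᴴ Δ_d)` (zero-field `d_{x²-y²}` pair long-range order of the TRACIAL ground state of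
  `hubbardTorusWith 2 (L+1) 1 U μ`), then `√(a/2) ≤ dWaveOrderParameter U μ` — in particular `HasDWaveOrder U μ`.

This is Koma–Tasaki, CMP 158 (1993) Thm 7.1/7.3 / J. Stat. Phys. 76 (1994) Thm 2.2 (Kaplan–Horsch–von der Linden
1989) transposed to the pair operator of the Hubbard model: "LRO without explicit symmetry breaking in finite volume
⇒ symmetry breaking under an infinitesimal source, thermodynamic limit first", with the explicit constant `√(a/2)`
in the tree's normalisation `dWaveSourceDensity = Re ω(Δ_d)/L²`. It is the cheap (proved) direction; the converse
(SSB ⇒ LRO, KT 1994 Conj. 10) is the shared crux `SsbToTorusLRO` and is not touched. Consumers: this crux's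
composition `nodalReduction_of_zeroField` (Defs file), the sibling crux `WeakCouplingBCS.WcbcsBcsConstruction`
(any zero-field plateau construction upgrades to `HasDWaveOrder`), and the `2009` chain.
-/

noncomputable section

-- `Summit.HubbardSuperconductivity.HubbardSuperconductivity.…` is the tree's summit/sub-problem namespace (D-0017).
set_option linter.dupNamespace false

namespace Summit.HubbardSuperconductivity.HubbardSuperconductivity.Theorems.NodalReduction

open scoped Matrix

/-- **Koma–Tasaki bridge for the Hubbard torus (unconditional).** A plateau `a > 0` of zero-field `d_{x²-y²}`
pair long-range order in the tracial grand-canonical ground state, `a (L+1)⁴ ≤ Re ω₀^{L+1}(Δ_dᴴΔ_d)` eventually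
in `L`, forces `√(a/2) ≤ dWaveOrderParameter U μ` (Koma–Tasaki 1993 Thm 7.1/7.3; 1994 Thm 2.2). -/
theorem ktBridge : KTBridge :=
  stub_ktBridge_of stub_trialStateBound stub_doubleCommutatorForm stub_orderSqLower stub_selectionRules
    stub_goodGroundVector

/-- Pointwise consequence in the route's language: zero-field plateau pair LRO at `(U, μ)` gives Koma–Tasaki
`d`-wave order `HasDWaveOrder U μ`. -/
theorem hasDWaveOrder_of_plateau (U μ a : ℝ) (ha : 0 < a)
    (hplat : ∀ᶠ L : ℕ in Filter.atTop, a * (((L + 1 : ℕ) : ℝ)) ^ 4 ≤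
      ((Literature.MathematicalPhysics.QuantumLattice.hubbardTorusWith 2 (L + 1) 1 U μ).groundStateFunctional
        ((Literature.MathematicalPhysics.QuantumLattice.pairField
            Literature.MathematicalPhysics.QuantumLattice.dWaveFormFactor (L + 1))ᴴ *
          Literature.MathematicalPhysics.QuantumLattice.pairField
            Literature.MathematicalPhysics.QuantumLattice.dWaveFormFactor (L + 1))).re) :
    Literature.MathematicalPhysics.QuantumLattice.HasDWaveOrder U μ := by
  have h : Real.sqrt (a / 2) ≤ Literature.MathematicalPhysics.QuantumLattice.dWaveOrderParameter U μ :=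
    ktBridge U μ a ha hplat
  have hs : (0 : ℝ) < Real.sqrt (a / 2) := Real.sqrt_pos.2 (by linarith)
  exact lt_of_lt_of_le hs h

end Summit.HubbardSuperconductivity.HubbardSuperconductivity.Theorems.NodalReduction

end
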